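import Literature.AlgebraicGeometry.AbelianSchemes.AbelianSchemeDualIsogeny
import Literature.AlgebraicGeometry.AbelianSchemes.RigidifiedLineBundleTensor
import HarnessLib

/-!
# The dual homomorphism `ψ^∨ : B̂ → Â′` preserves the unit section and is a homomorphism

Layer `Literature/AlgebraicGeometry/AbelianSchemes`, namespace `Literature.AlgebraicGeometry.AbelianSchemes.AbelianSchemeOver(.DualPair)`.
THEOREMS ONLY (no definition, no named fact, no instance).

Setting of ★ `AbelianSchemeDualIsogeny` ((e1): `ψ : A′ → B` a homomorphism of abelian schemes over `S`, dual pairs `D′` of `A′`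
and `DB` of `B`, `ψ^∨ := D′.classify _ ((ψ × 1)^*𝒫_B)` = ★ `dualIsogeny ψ D′ DB`, `dualIsogenyOver` in `Over S`).  As for ★
`AbelianSchemeDualTransport` §4 (`Ĥ_e` for an isomorphism `e`), the unit-section normalisations `hDB : 𝒫_B|_{B × {ε_{B̂}}} ≅ 𝒪`,
`hD′ : 𝒫′|_{A′ × {ε_{Â′}}} ≅ 𝒪` (RAW hypotheses — ★ `DualPair` normalises along `ε_A × 1` only; automatic for polarised abelian
schemes) give:

* (§1 is ★ `RigidifiedLineBundleTensor.DualPair.nonempty_pullbackP_comp_unitSection_iso` (B-p05 (g15)), REUSED by import: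
  for any `f : T → S`, `(1_A × (f ≫ ε_Â))^*𝒫 ≅ 𝒪` under `hD`.)
* §2 (private `baseChangeHom_left_snd`, = ★ `IsLambdaOfAtAlongDualIsogeny.baseChangeHom_left_comp_snd`), `DualPair.restrictLeft_unitSection_comp_baseChangeHom_left`,
  `DualPair.nonempty_comap_unitSection_pullbackSelfBundle_iso` — `((ψ × 1)^*𝒫_B)|_{ε_{B̂}} ≅ 𝒪` under `hDB`
  (`(1 × ε_{B̂}) ≫ (ψ × 1) = (pr ≫ ψ) ≫ (B × {ε_{B̂}})`).
* §3 **`DualPair.unitSection_comp_dualIsogeny (hDB) (hD′) : ε_{B̂} ≫ ψ^∨ = ε_{Â′}`** — both classify the trivial family on `A′`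
  over the base `ε_{B̂} ≫ (B̂ → S)` (★ `classify_comap`-road: ★ `nonempty_pullbackP_comp_iso_comap` + §1 + §2 + ★
  `eq_of_nonempty_iso`); **`DualPair.one_comp_dualIsogenyOver`** (`η ≫ ψ^∨ = η` in `Over S`);
  **`DualPair.isMonHom_dualIsogenyOver [IsReduced S] [IsLocallyNoetherian S]`** — over a reduced locally Noetherian base a
  unit-preserving `S`-morphism of abelian schemes is a homomorphism (★ `isMonHom_of_one_comp_of_isReduced_base`,
  [MumfordFogartyKirwan1994] Cor. 6.4).

Cell `hodgecm-mathlib` (D-0151), HECKE-LINK H2 (e1′) (B-p20 (g9) hand 21:28:26Z); consumer (γ): `IsLambdaOfAt … (ψ ≫ λ_B ≫ ψ^∨)`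
needs `IsMonHom` of the composite (B-p11 (g13) / B-p04 (g17)).  Count-neutral; HC_CM is proved only modulo the 7 printed citations
until rung 0 closes.

## References
* [MilneAV2008] J. S. Milne, *Abelian Varieties* (v2.00, 2008), I §8 pp. 36–37 (uniqueness of the classifying morphism), I §9
  Thm. 9.1 (p. 42).
* [MumfordAV1970] D. Mumford, *Abelian Varieties* (1970), §15 Thm. 1 (p. 143) (the dual isogeny), §13 (p. 125).
* [MumfordFogartyKirwan1994] D. Mumford, J. Fogarty, F. Kirwan, *GIT* 3rd ed. (1994), Ch. 6 §1 Cor. 6.4 (p. 117), Ch. 7 §2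
  Def. 7.3 (p. 129).
-/

set_option autoImplicit false

noncomputable section

universe u

open CategoryTheory CategoryTheory.Limits AlgebraicGeometry
open scoped MonObj

namespace Literature.AlgebraicGeometry.AbelianSchemes

namespace AbelianSchemeOver

variable {S : Scheme.{u}}

/-! ## §2 `((ψ × 1)^*𝒫_B)|_{ε_{B̂}} ≅ 𝒪` -/

section Slice

variable {A' B : AbelianSchemeOver S} (ψ : A'.X ⟶ B.X)

/-- `(ψ ×_S T) ≫ pr_T = pr_T` (a `private` copy: the same statement is ★ `IsLambdaOfAtAlongDualIsogeny.baseChangeHom_left_comp_snd`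
(p746535, landed minutes before this file; not imported to stay off its olean)). [cite: MilneAV2008, I §8 pp. 36–37] -/
@[reassoc]
private theorem baseChangeHom_left_snd {T : Scheme.{u}} (f : T ⟶ S) :
    (baseChangeHom ψ f).left ≫ pullback.snd B.X.hom f = pullback.snd A'.X.hom f := by
  change pullback.lift _ _ _ ≫ _ = _
  exact pullback.lift_snd _ _ _

variable (DB : B.DualPair)

/-- **`(1_{A′} × ε_{B̂}) ≫ (ψ × 1_{B̂}) = (pr_{A′} ≫ ψ) ≫ (B × {ε_{B̂}})`** as morphisms `A′ ×_S S → B ×_S B̂` (over the base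
`ε_{B̂} ≫ (B̂ → S)`; both projections agree). [cite: MilneAV2008, I §8 pp. 36–37] -/
theorem DualPair.restrictLeft_unitSection_comp_baseChangeHom_left :
    A'.restrictLeft DB.hat.X.hom DB.hat.unitSection ≫ (baseChangeHom ψ DB.hat.X.hom).left =
      (pullback.fst A'.X.hom (DB.hat.unitSection ≫ DB.hat.X.hom) ≫ ψ.left) ≫ DualPair.unitHatSlice DB := by
  have hψ : ψ.left ≫ B.X.hom = A'.X.hom := Over.w ψ
  have hε : (DB.hat.unitSection ≫ DB.hat.X.hom) ≫ DB.hat.unitSection = DB.hat.unitSection := by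
    rw [DB.hat.unitSection_comp_hom, Category.id_comp]
  apply pullback.hom_ext
  · calc (A'.restrictLeft DB.hat.X.hom DB.hat.unitSection ≫ (baseChangeHom ψ DB.hat.X.hom).left) ≫
            pullback.fst B.X.hom DB.hat.X.hom
          = A'.restrictLeft DB.hat.X.hom DB.hat.unitSection ≫
              ((baseChangeHom ψ DB.hat.X.hom).left ≫ pullback.fst B.X.hom DB.hat.X.hom) := Category.assoc _ _ _
      _ = A'.restrictLeft DB.hat.X.hom DB.hat.unitSection ≫ (pullback.fst A'.X.hom DB.hat.X.hom ≫ ψ.left) :=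
            congrArg (fun x => A'.restrictLeft DB.hat.X.hom DB.hat.unitSection ≫ x)
              (baseChangeHom_left_comp_fst ψ DB.hat.X.hom)
      _ = (A'.restrictLeft DB.hat.X.hom DB.hat.unitSection ≫ pullback.fst A'.X.hom DB.hat.X.hom) ≫ ψ.left :=
            (Category.assoc _ _ _).symm
      _ = pullback.fst A'.X.hom (DB.hat.unitSection ≫ DB.hat.X.hom) ≫ ψ.left :=
            congrArg (fun x => x ≫ ψ.left) (A'.restrictLeft_fst DB.hat.X.hom DB.hat.unitSection)
      _ = (pullback.fst A'.X.hom (DB.hat.unitSection ≫ DB.hat.X.hom) ≫ ψ.left) ≫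
            (DualPair.unitHatSlice DB ≫ pullback.fst B.X.hom DB.hat.X.hom) :=
            (Category.comp_id _).symm.trans
              (congrArg (fun x => (pullback.fst A'.X.hom (DB.hat.unitSection ≫ DB.hat.X.hom) ≫ ψ.left) ≫ x)
                (DualPair.unitHatSlice_fst DB).symm)
      _ = ((pullback.fst A'.X.hom (DB.hat.unitSection ≫ DB.hat.X.hom) ≫ ψ.left) ≫ DualPair.unitHatSlice DB) ≫
            pullback.fst B.X.hom DB.hat.X.hom := (Category.assoc _ _ _).symm
  · calc (A'.restrictLeft DB.hat.X.hom DB.hat.unitSection ≫ (baseChangeHom ψ DB.hat.X.hom).left) ≫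
            pullback.snd B.X.hom DB.hat.X.hom
          = A'.restrictLeft DB.hat.X.hom DB.hat.unitSection ≫
              ((baseChangeHom ψ DB.hat.X.hom).left ≫ pullback.snd B.X.hom DB.hat.X.hom) := Category.assoc _ _ _
      _ = A'.restrictLeft DB.hat.X.hom DB.hat.unitSection ≫ pullback.snd A'.X.hom DB.hat.X.hom :=
            congrArg (fun x => A'.restrictLeft DB.hat.X.hom DB.hat.unitSection ≫ x)
              (baseChangeHom_left_snd ψ DB.hat.X.hom)
      _ = pullback.snd A'.X.hom (DB.hat.unitSection ≫ DB.hat.X.hom) ≫ DB.hat.unitSection :=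
            A'.restrictLeft_snd DB.hat.X.hom DB.hat.unitSection
      _ = pullback.snd A'.X.hom (DB.hat.unitSection ≫ DB.hat.X.hom) ≫
            ((DB.hat.unitSection ≫ DB.hat.X.hom) ≫ DB.hat.unitSection) := by rw [hε]
      _ = (pullback.snd A'.X.hom (DB.hat.unitSection ≫ DB.hat.X.hom) ≫ (DB.hat.unitSection ≫ DB.hat.X.hom)) ≫
            DB.hat.unitSection := (Category.assoc _ _ _).symm
      _ = (pullback.fst A'.X.hom (DB.hat.unitSection ≫ DB.hat.X.hom) ≫ A'.X.hom) ≫ DB.hat.unitSection :=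
            congrArg (fun x => x ≫ DB.hat.unitSection)
              (pullback.condition (f := A'.X.hom) (g := DB.hat.unitSection ≫ DB.hat.X.hom)).symm
      _ = (pullback.fst A'.X.hom (DB.hat.unitSection ≫ DB.hat.X.hom) ≫ (ψ.left ≫ B.X.hom)) ≫ DB.hat.unitSection := by
            rw [hψ]
      _ = (pullback.fst A'.X.hom (DB.hat.unitSection ≫ DB.hat.X.hom) ≫ ψ.left) ≫ (B.X.hom ≫ DB.hat.unitSection) := by
            simp only [Category.assoc]
      _ = (pullback.fst A'.X.hom (DB.hat.unitSection ≫ DB.hat.X.hom) ≫ ψ.left) ≫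
            (DualPair.unitHatSlice DB ≫ pullback.snd B.X.hom DB.hat.X.hom) :=
            congrArg (fun x => (pullback.fst A'.X.hom (DB.hat.unitSection ≫ DB.hat.X.hom) ≫ ψ.left) ≫ x)
              (DualPair.unitHatSlice_snd DB).symm
      _ = ((pullback.fst A'.X.hom (DB.hat.unitSection ≫ DB.hat.X.hom) ≫ ψ.left) ≫ DualPair.unitHatSlice DB) ≫
            pullback.snd B.X.hom DB.hat.X.hom := (Category.assoc _ _ _).symm

/-- **`((ψ × 1)^*𝒫_B)|_{ε_{B̂}} ≅ 𝒪`**: the restriction of the rigidified family `(ψ × 1)^*𝒫_B` (★ `pullbackSelfBundle`) along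
the unit section `ε_{B̂} : S → B̂` is trivial when `𝒫_B|_{B × {ε_{B̂}}}` is (`hDB`). [cite: MilneAV2008, I §8 pp. 36–37] -/
theorem DualPair.nonempty_comap_unitSection_pullbackSelfBundle_iso [IsMonHom ψ]
    (hDB : Nonempty ((Scheme.Modules.pullback (DualPair.unitHatSlice DB)).obj DB.P ≅ SheafOfModules.unit _)) :
    Nonempty (((DualPair.pullbackSelfBundle ψ DB).comap DB.hat.unitSection).L ≅ SheafOfModules.unit _) :=
  ⟨(DualPair.pullbackSelfBundle ψ DB).comapLIso DB.hat.unitSection ≪≫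
    (Scheme.Modules.pullbackComp _ _).app DB.P ≪≫
    (Scheme.Modules.pullbackCongr (DualPair.restrictLeft_unitSection_comp_baseChangeHom_left ψ DB)).app DB.P ≪≫
    ((Scheme.Modules.pullbackComp _ _).app DB.P).symm ≪≫
    (Scheme.Modules.pullback _).mapIso hDB.some ≪≫ RigidifiedLineBundle.pullbackUnitIso _⟩

end Slice

/-! ## §3 `ψ^∨` preserves the unit section; over a reduced base it is a homomorphism -/

namespace DualPair

variable {A' B : AbelianSchemeOver S} (ψ : A'.X ⟶ B.X) [IsMonHom ψ] (D' : A'.DualPair) (DB : B.DualPair)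

/-- **`ψ^∨` PRESERVES THE UNIT SECTIONS: `ε_{B̂} ≫ ψ^∨ = ε_{Â′}`** — both `S`-morphisms classify the trivial rigidified family on
`A′` over the base `ε_{B̂} ≫ (B̂ → S)`: `ε_{B̂} ≫ ψ^∨` classifies `((ψ × 1)^*𝒫_B)|_{ε_{B̂}} ≅ 𝒪` (★ `nonempty_pullbackP_comp_iso_comap`,
§2 under `hDB`) and `ε_{Â′}` classifies `(1 × ε_{Â′})^*𝒫′ ≅ 𝒪` (★ `nonempty_pullbackP_comp_unitSection_iso` under `hD′`); uniqueness in [MilneAV2008] I §8 (★ `eq_of_nonempty_iso`).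
[cite: MilneAV2008, I §8 pp. 36–37] [cite: MumfordFogartyKirwan1994, Ch. 7 §2 Definition 7.3 (p. 129)] -/
theorem unitSection_comp_dualIsogeny
    (hDB : Nonempty ((Scheme.Modules.pullback (unitHatSlice DB)).obj DB.P ≅ SheafOfModules.unit _))
    (hD' : Nonempty ((Scheme.Modules.pullback (unitHatSlice D')).obj D'.P ≅ SheafOfModules.unit _)) :
    DB.hat.unitSection ≫ dualIsogeny ψ D' DB = D'.hat.unitSection := by
  -- base morphism `ε_{B̂} ≫ (B̂ → S)` (= `𝟙 S`, but kept in this form to avoid transports)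
  have hg₁ : (DB.hat.unitSection ≫ dualIsogeny ψ D' DB) ≫ D'.hat.X.hom = DB.hat.unitSection ≫ DB.hat.X.hom := by
    rw [Category.assoc, dualIsogeny_comp_hom]
  have hg₂ : D'.hat.unitSection ≫ D'.hat.X.hom = DB.hat.unitSection ≫ DB.hat.X.hom := by
    rw [D'.hat.unitSection_comp_hom, DB.hat.unitSection_comp_hom]
  have hg₂' : (DB.hat.unitSection ≫ DB.hat.X.hom) ≫ D'.hat.unitSection = D'.hat.unitSection := by
    rw [DB.hat.unitSection_comp_hom, Category.id_comp]
  -- the trivial family over that base, in the currency `((ψ × 1)^*𝒫_B)|_{ε_{B̂}}`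
  obtain ⟨i₀⟩ := nonempty_comap_unitSection_pullbackSelfBundle_iso ψ DB hDB
  refine D'.eq_of_nonempty_iso (DB.hat.unitSection ≫ DB.hat.X.hom) ((pullbackSelfBundle ψ DB).comap DB.hat.unitSection)
    ((pullbackSelfBundle_fibrewisePicZero ψ DB).comap DB.hat.unitSection) _ _ hg₁ hg₂ ?_ ?_
  · -- `ε_{B̂} ≫ ψ^∨` classifies the restriction of `(ψ × 1)^*𝒫_B` along `ε_{B̂}`
    exact D'.nonempty_pullbackP_comp_iso_comap DB.hat.unitSection (pullbackSelfBundle ψ DB)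
      (dualIsogeny_comp_hom ψ D' DB) hg₁ (nonempty_pullbackP_dualIsogeny_iso ψ D' DB)
  · -- `ε_{Â′}` classifies the trivial family
    obtain ⟨i₁⟩ := D'.nonempty_pullbackP_comp_unitSection_iso (DB.hat.unitSection ≫ DB.hat.X.hom) hD'
      (by rw [Category.assoc, D'.hat.unitSection_comp_hom, Category.comp_id])
    exact ⟨eqToIso (D'.pullbackP_congr _ hg₂'.symm hg₂ _) ≪≫ i₁ ≪≫ i₀.symm⟩

/-- `η_{B̂} ≫ ψ^∨ = η_{Â′}` in `Over S`. [cite: MumfordFogartyKirwan1994, Ch. 7 §2 Definition 7.3 (p. 129)] -/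
theorem one_comp_dualIsogenyOver
    (hDB : Nonempty ((Scheme.Modules.pullback (unitHatSlice DB)).obj DB.P ≅ SheafOfModules.unit _))
    (hD' : Nonempty ((Scheme.Modules.pullback (unitHatSlice D')).obj D'.P ≅ SheafOfModules.unit _)) :
    η[DB.hat.X] ≫ dualIsogenyOver ψ D' DB = η[D'.hat.X] :=
  Over.OverMorphism.ext (by
    rw [Over.comp_left, dualIsogenyOver_left]
    exact unitSection_comp_dualIsogeny ψ D' DB hDB hD')

/-- **`ψ^∨ : B̂ → Â′` IS A HOMOMORPHISM of `S`-group schemes over a REDUCED locally Noetherian base** — it preserves the unit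
(`one_comp_dualIsogenyOver`), and a unit-preserving `S`-morphism of abelian schemes over such a base is a homomorphism
([MumfordFogartyKirwan1994] Cor. 6.4, ★ `isMonHom_of_one_comp_of_isReduced_base`).  A theorem, not an instance.
[cite: MumfordFogartyKirwan1994, Ch. 6 §1 Corollary 6.4 (p. 117)] [cite: MumfordAV1970, §15 Thm. 1 (p. 143)] -/
theorem isMonHom_dualIsogenyOver [IsReduced S] [IsLocallyNoetherian S]
    (hDB : Nonempty ((Scheme.Modules.pullback (unitHatSlice DB)).obj DB.P ≅ SheafOfModules.unit _))
    (hD' : Nonempty ((Scheme.Modules.pullback (unitHatSlice D')).obj D'.P ≅ SheafOfModules.unit _)) :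
    IsMonHom (dualIsogenyOver ψ D' DB) :=
  isMonHom_of_one_comp_of_isReduced_base (dualIsogenyOver ψ D' DB) (one_comp_dualIsogenyOver ψ D' DB hDB hD')

end DualPair

end AbelianSchemeOver

end Literature.AlgebraicGeometry.AbelianSchemes

end
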